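import Literature.AlgebraicTopology.SingularHomology.RelativeHomotopyAddition
import Literature.AlgebraicTopology.SingularHomology.RelSimplexClassRigidity
import Literature.AlgebraicTopology.SingularHomology.RelativeHomotopyAdditionTwoProofs
import HarnessLib

/-!
# Proof of the relative homotopy addition theorem `relHomotopyAddition` (Spanier Prop. 7.5.3 `Bₙ`)

Topic `Literature/AlgebraicTopology/SingularHomology`, sibling proof file of
`RelativeHomotopyAddition.lean`, whose named fact `relHomotopyAddition` — E. H. Spanier, *Algebraic
Topology* (1966; Springer 1981), Ch. 7 §5, **Prop. 3 (`Bₙ`, `n ≥ 3`)**, `j_# bₙ = 0` with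
`bₙ = h_{[v₀v₁]}[e⁰ₙ₊₁] + ∑_{0<i≤n+1} (-1)ⁱ [eⁱₙ₊₁]`, in the pushed-forward form of part (d) of the proof
of Thm. 7.5.4 (p. 397: "`∑ (-1)ⁱ [σ⁽ⁱ⁾]' = η σ_# j_# (bₙ) = 0`"), for `A` simply connected, `n = k + 3`,
and the classes `relSimplexClass` of `RelativeSimplexClass.lean` — is DISCHARGED here:

* `relHomotopyAddition_holds : relHomotopyAddition`.

Proof. (1) **Normalising the edges** (`exists_edge_normalisation`): since `A` is simply connected,
every edge `τ ∘ δᵢ ∘ … ` of `τ` — a loop at `a` in `A` — is null-homotopic in `A` rel end points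
(`RelHomotopyAdditionTwo.exists_nullHomotopy_of_goodEdge`); these homotopies extend level by level over
all faces by the homotopy extension property of `(Δ^q, ∂Δ^q)` (`SimplexPrism.exists_fill`,
`Homotopy/SimplexPrismExtension.lean`, Hatcher Prop. 0.16), inside `↥A` over faces lying in `A` and in
`X` otherwise (the tower pattern of Spanier Thm. 7.4.8 / `RelativeHomotopyAdditionTwoProofs.lean`, run to
dimension `k + 4` with vertices kept fixed). Along the deformation every facet stays a map of triples
`(Δᵏ⁺³, ∂Δᵏ⁺³, v₀) → (X, A, a)`, so the classes `[τ ∘ δᵢ]` are unchanged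
(`relSimplexClass_eq_of_homotopyWith`), and the end `τ'` sends the edge `[v₀, v₁]` to `a`.
(2) For such `τ'` the theorem is `sum_neg_one_pow_smul_relSimplexClass_eq_zero`
(`RelSimplexClassRigidity.lean`): the cone-class homotopy addition theorem of
`RelativeHomotopyAdditionCone.lean` (join cube + cubical homotopy addition theorem in the path space)
transported by the device rigidity `relSimplexClass α = (coneClass α)^{±1}` (Spanier p. 391 sign).

## References

* E. H. Spanier, *Algebraic Topology*, Springer (1981), Ch. 7 §5 Prop. 3 and (d) p. 397; §4 Thm. 8
  (the tower), p. 391 (the identification). [Spanier1981]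
* A. Hatcher, *Algebraic Topology*, CUP (2002), Prop. 0.16, §4.1 Lemma 4.7, §4.2 Thm. 4.32. [HatcherAT2002]
-/

noncomputable section

open Set Function
open scoped unitInterval Topology
open Literature.AlgebraicTopology.Homotopy

universe u

namespace Literature.AlgebraicTopology.SingularHomology

open SingularSimplex RelHomotopyAdditionTwo

variable {X : Type u} [TopologicalSpace X] {A : Set X} {a : A}

/-! ### The edge-normalising tower -/

section Tower

variable (A a) in
/-- **The properties of the level-`q` homotopies of the edge-normalising tower**: they start at the
simplex, keep the vertices fixed, stay in `A` over simplices of `A`, end with the `1`-skeleton at `a`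
when the edges of the simplex are loops at `a` in `A`, and prescribe compatible data over the faces
of every `(q+1)`-simplex. [folklore] -/
structure EdgeGood (q : ℕ) (P : SingularSimplex X q → C(StdSimplex q × I, X)) : Prop where
  /-- the homotopy starts at the simplex -/
  bot : ∀ (η : SingularSimplex X q) (t : StdSimplex q), P η (t, 0) = toContinuousMap η t
  /-- the vertices do not move -/
  vert : ∀ (η : SingularSimplex X q), ∀ t ∈ stdSkel q 0, ∀ s : I, P η (t, s) = toContinuousMap η t
  /-- if the `1`-skeleton goes into `A` and the vertices to `a`, the end map sends the `1`-skeleton to `a` -/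
  one : ∀ (η : SingularSimplex X q), (∀ t ∈ stdSkel q 1, toContinuousMap η t ∈ A) →
    (∀ t ∈ stdSkel q 0, toContinuousMap η t = a) → ∀ t ∈ stdSkel q 1, P η (t, 1) = a
  /-- the homotopy stays in `A` for simplices of `A` -/
  inA : ∀ (η : SingularSimplex X q), η.range ⊆ A → ∀ (t : StdSimplex q) (s : I), P η (t, s) ∈ A
  /-- the face homotopies of every `(q+1)`-simplex are compatible -/
  compat : ∀ τ : SingularSimplex X (q + 1), SimplexPrism.Compatible fun i => P (τ.face i)

/-- Level `q + 1` restricts on the faces to level `q`. [folklore] -/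
def EdgeRestr (q : ℕ) (P' : SingularSimplex X (q + 1) → C(StdSimplex (q + 1) × I, X))
    (P : SingularSimplex X q → C(StdSimplex q × I, X)) : Prop :=
  ∀ (η : SingularSimplex X (q + 1)) (i : Fin (q + 2)) (t : StdSimplex q) (s : I),
    P' η (stdFace i t, s) = P (η.face i) (t, s)

/-- **Level `0`**: constant homotopies. [folklore] -/
theorem edgeGood_zero : EdgeGood A a 0 (fun v => (toContinuousMap v).comp ContinuousMap.fst) :=
  { bot := fun _ _ => rfl
    vert := fun _ _ _ _ => rfl
    one := fun η _ hv t _ => hv t (by rw [stdSkel_eq_univ le_rfl]; exact mem_univ _)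
    inA := fun η hη t _ => hη ⟨t, rfl⟩
    compat := fun τ => EilenbergRetraction.compatible_faces_zero
      (fun v : SingularSimplex X 0 => (toContinuousMap v).comp ContinuousMap.fst) τ }

/-- **Level `1`** (`A` simply connected): the null-homotopies of good edges of
`RelativeHomotopyAdditionTwoProofs.lean` (`RelHomotopyAdditionTwo.P₁`). [folklore] -/
theorem edgeGood_one [SimplyConnectedSpace A] :
    EdgeGood A a 1 (P₁ A a) ∧ EdgeRestr 0 (P₁ A a) (fun v => (toContinuousMap v).comp ContinuousMap.fst) := by
  refine ⟨{ bot := fun η t => P₁_zero η t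
            vert := fun η t ht s => P₁_of_mem_stdBoundary η (by rwa [stdBoundary_eq_stdSkel]) s
            one := fun η hA hv t _ => ?_
            inA := fun η hη t s => ?_
            compat := fun τ => compatible_P₁ τ }, fun η i t s => ?_⟩
  · have hgood : GoodEdge A a (toContinuousMap η) :=
      ⟨fun t => hA t (by rw [stdSkel_eq_univ le_rfl]; exact mem_univ _),
        fun v hv' => hv v (by rwa [stdBoundary_eq_stdSkel] at hv')⟩
    exact P₁_one hgood t
  · by_cases h : GoodEdge A a (toContinuousMap η)
    · exact P₁_mem h _
    · unfold P₁; rw [dif_neg h]; exact hη ⟨t, rfl⟩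
  · show P₁ A a η (stdFace i t, s) = toContinuousMap (η.face i) t
    rw [P₁_of_mem_stdBoundary η (stdFace_mem_stdBoundary i t), toContinuousMap_face_apply]

/-- A point of the `0`-skeleton of `Δ^{q+1}` lies on a facet, at a vertex of the facet. [folklore] -/
lemma exists_eq_stdFace_of_mem_stdSkel_zero {q : ℕ} {t : StdSimplex (q + 1)} (ht : t ∈ stdSkel (q + 1) 0) :
    ∃ (i : Fin (q + 2)) (z : StdSimplex q), stdFace i z = t ∧ z ∈ stdSkel q 0 := by
  have ht' : t ∈ stdBoundary (q + 1) := by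
    rw [stdBoundary_eq_stdSkel]; exact stdSkel_mono _ (by omega) ht
  obtain ⟨i, hi⟩ := ht'
  obtain ⟨z, rfl⟩ := exists_stdFace_eq i t hi
  exact ⟨i, z, rfl, (stdFace_mem_stdSkel_iff i z).1 ht⟩

/-- **Level `q + 2` from level `q + 1`**: fill the prism over every `(q+2)`-simplex with the given
data on its faces (`SimplexPrism.exists_fill`), inside `↥A` for simplices of `A`. [folklore] -/
theorem exists_edgeGood_succ_succ {q : ℕ} (P : SingularSimplex X (q + 1) → C(StdSimplex (q + 1) × I, X))
    (hP : EdgeGood A a (q + 1) P) :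
    ∃ P' : SingularSimplex X (q + 2) → C(StdSimplex (q + 2) × I, X), EdgeGood A a (q + 2) P' ∧ EdgeRestr (q + 1) P' P := by
  have hbot : ∀ (η : SingularSimplex X (q + 2)) (i : Fin (q + 3)) (t : StdSimplex (q + 1)),
      P (η.face i) (t, 0) = toContinuousMap η (stdFace i t) := fun η i t => by
    rw [hP.bot, toContinuousMap_face_apply]
  have key : ∀ η : SingularSimplex X (q + 2), ∃ G : C(StdSimplex (q + 2) × I, X),
      (∀ t, G (t, 0) = toContinuousMap η t) ∧
        (∀ (i : Fin (q + 3)) (t : StdSimplex (q + 1)) (s : I), G (stdFace i t, s) = P (η.face i) (t, s)) ∧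
        (η.range ⊆ A → ∀ (t : StdSimplex (q + 2)) (s : I), G (t, s) ∈ A) := by
    intro η
    by_cases hA : η.range ⊆ A
    · have hfaceA : ∀ i : Fin (q + 3), (η.face i).range ⊆ A := fun i => (range_face_subset i η).trans hA
      let fA : C(StdSimplex (q + 2), A) :=
        ⟨fun t => ⟨toContinuousMap η t, hA ⟨t, rfl⟩⟩, (toContinuousMap η).continuous.subtype_mk _⟩
      let FA : Fin (q + 3) → C(StdSimplex (q + 1) × I, A) := fun i =>
        ⟨fun p => ⟨P (η.face i) p, hP.inA _ (hfaceA i) p.1 p.2⟩, (P (η.face i)).continuous.subtype_mk _⟩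
      have hFA : SimplexPrism.Compatible FA := fun i j t t' s h => Subtype.ext (hP.compat η i j t t' s h)
      have hbotA : ∀ i t, FA i (t, 0) = fA (stdFace i t) := fun i t => Subtype.ext (hbot η i t)
      obtain ⟨GA, hGA0, hGAs⟩ := SimplexPrism.exists_fill fA FA hFA hbotA
      let G : C(StdSimplex (q + 2) × I, X) := ⟨fun p => (GA p : X), continuous_subtype_val.comp GA.continuous⟩
      exact ⟨G, fun t => congrArg Subtype.val (hGA0 t), fun i t s => congrArg Subtype.val (hGAs i t s),
        fun _ t s => (GA (t, s)).2⟩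
    · obtain ⟨G, hG0, hGs⟩ := SimplexPrism.exists_fill (toContinuousMap η) (fun i => P (η.face i)) (hP.compat η) (hbot η)
      exact ⟨G, hG0, hGs, fun h => absurd h hA⟩
  choose P' hB' hS' hA' using key
  refine ⟨P', ⟨hB', fun η t ht s => ?_, fun η h1 hv t ht => ?_, hA',
    fun τ => EilenbergRetraction.compatible_faces_succ P' P hS' τ⟩, hS'⟩
  · obtain ⟨i, z, rfl, hz⟩ := exists_eq_stdFace_of_mem_stdSkel_zero ht
    rw [hS', hP.vert _ z hz, toContinuousMap_face_apply]
  · obtain ⟨i, z, rfl, hz⟩ := RelEilenbergRetraction₁.exists_eq_stdFace_of_mem_stdSkel_one ht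
    rw [hS']
    refine hP.one _ (fun w hw => ?_) (fun w hw => ?_) z hz
    · rw [toContinuousMap_face_apply]; exact h1 _ (stdFace_mem_stdSkel i hw)
    · rw [toContinuousMap_face_apply]; exact hv _ (stdFace_mem_stdSkel i hw)

/-- **The tower up to any height**: levels `q + 1`, `q + 2` with the restriction property
(`A` simply connected). [folklore] -/
theorem exists_edgeGood_pair [SimplyConnectedSpace A] (q : ℕ) :
    ∃ (P : SingularSimplex X (q + 1) → C(StdSimplex (q + 1) × I, X))
      (P' : SingularSimplex X (q + 2) → C(StdSimplex (q + 2) × I, X)),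
      EdgeGood A a (q + 1) P ∧ EdgeGood A a (q + 2) P' ∧ EdgeRestr (q + 1) P' P := by
  induction q with
  | zero =>
    obtain ⟨h1, -⟩ := edgeGood_one (A := A) (a := a)
    obtain ⟨P', hP', hR⟩ := exists_edgeGood_succ_succ _ h1
    exact ⟨_, P', h1, hP', hR⟩
  | succ q ih =>
    obtain ⟨-, P', -, hP', -⟩ := ih
    obtain ⟨P'', hP'', hR⟩ := exists_edgeGood_succ_succ _ hP'
    exact ⟨P', P'', hP', hP'', hR⟩

end Tower

/-! ### Normalising the edges of a simplex -/

/-- A point of the codimension-two skeleton of `Δ^{q+2}` is `δᵢ δⱼ z`. [folklore] -/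
lemma exists_eq_stdFace_stdFace_of_mem_stdSkel {q : ℕ} {t : StdSimplex (q + 2)} (ht : t ∈ stdSkel (q + 2) q) :
    ∃ (i : Fin (q + 3)) (j : Fin (q + 2)) (z : StdSimplex q), stdFace i (stdFace j z) = t := by
  have hb : t ∈ stdBoundary (q + 2) := by
    rw [stdBoundary_eq_stdSkel]; exact stdSkel_mono _ (by omega) ht
  obtain ⟨i, hi⟩ := hb
  obtain ⟨t', rfl⟩ := exists_stdFace_eq i t hi
  have hb' : t' ∈ stdBoundary (q + 1) := by
    rw [stdBoundary_eq_stdSkel]; exact (stdFace_mem_stdSkel_iff i t').1 ht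
  obtain ⟨j, hj⟩ := hb'
  obtain ⟨z, rfl⟩ := exists_stdFace_eq j t' hj
  exact ⟨i, j, z, rfl⟩

/-- A point of the `0`-skeleton of `Δ^q` is a vertex (exactly one non-zero coordinate, which is
then `1`). [folklore] -/
lemma exists_eq_vertex_of_mem_stdSkel_zero {q : ℕ} {t : StdSimplex q} (ht : t ∈ stdSkel q 0) :
    ∃ i : Fin (q + 1), t = stdSimplex.vertex (S := ℝ) i := by
  rw [mem_stdSkel_iff] at ht
  obtain ⟨i, hi⟩ := StdSimplex.nzCoords_nonempty t
  have hzero : ∀ l, l ≠ i → (t : Fin (q + 1) → ℝ) l = 0 := fun l hl => by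
    by_contra h'
    exact hl (Finset.card_le_one.1 ht l ((StdSimplex.mem_nzCoords t l).2 h') i hi)
  have hti : (t : Fin (q + 1) → ℝ) i = 1 := by
    have hsum : ∑ l, (t : Fin (q + 1) → ℝ) l = 1 := t.2.2
    rwa [Finset.sum_eq_single i (fun l _ hl => hzero l hl) (fun h => absurd (Finset.mem_univ i) h)] at hsum
  refine ⟨i, stdSimplex.ext (funext fun j => ?_)⟩
  rw [stdSimplex.vertex_coe]
  by_cases hji : j = i
  · subst hji; rw [Pi.single_eq_same]; exact hti
  · rw [Pi.single_eq_of_ne hji]; exact hzero j hji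

/-- **Normalising the edges** (`A` simply connected): a simplex `τ : Δᵏ⁺⁴ → X` with codimension-two
skeleton in `A` and vertices at `a` is deformed — its facets moving through maps of triples
`(Δᵏ⁺³, ∂Δᵏ⁺³, v₀) → (X, A, a)`, so that their classes `relSimplexClass` do not change — into a simplex
`τ'` of the same kind which moreover sends the edge `[v₀, v₁]` (indeed its whole `1`-skeleton) to `a`
(homotopy extension, Hatcher 2002, Prop. 0.16, level by level as in Spanier's tower, Thm. 7.4.8).
[folklore] -/
theorem exists_edge_normalisation [SimplyConnectedSpace A] {k : ℕ} (τ : C(StdSimplex (k + 4), X))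
    (hA : ∀ t ∈ stdSkel (k + 4) (k + 2), τ t ∈ A) (hv : ∀ i : Fin (k + 5), τ (stdSimplex.vertex (S := ℝ) i) = a) :
    ∃ (τ' : C(StdSimplex (k + 4), X)) (hA' : ∀ t ∈ stdSkel (k + 4) (k + 2), τ' t ∈ A)
      (hv' : ∀ i : Fin (k + 5), τ' (stdSimplex.vertex (S := ℝ) i) = a),
      EdgeToBase a τ' ∧ ∀ i : Fin (k + 5),
        relSimplexClass (m := k + 2) (a := a) (τ.comp (stdFace i)) (comp_stdFace_mem_relSimplexMap (m := k + 2) τ hA hv i) =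
          relSimplexClass (m := k + 2) (a := a) (τ'.comp (stdFace i)) (comp_stdFace_mem_relSimplexMap (m := k + 2) τ' hA' hv' i) := by
  -- the tower: levels `k + 2`, `k + 3`, `k + 4`
  obtain ⟨P, P', hP, hP', hR'⟩ := exists_edgeGood_pair (A := A) (a := a) (k + 1)
  obtain ⟨P'', hP'', hR''⟩ := exists_edgeGood_succ_succ P' hP'
  set η : SingularSimplex X (k + 4) := ofMap τ with hη
  set G : C(StdSimplex (k + 4) × I, X) := P'' η with hG
  have hτη : ∀ t, toContinuousMap η t = τ t := fun t => by rw [hη, toContinuousMap_ofMap]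
  -- vertices of `τ` in terms of the skeleton
  have hv0 : ∀ t ∈ stdSkel (k + 4) 0, τ t = a := fun t ht => by
    obtain ⟨i, rfl⟩ := exists_eq_vertex_of_mem_stdSkel_zero ht
    exact hv i
  -- the deformed simplex
  let τ' : C(StdSimplex (k + 4), X) := ⟨fun t => G (t, 1), G.continuous.comp (Continuous.prodMk_left (1 : I))⟩
  -- codimension-two points stay in `A` along the deformation
  have hskelA : ∀ t ∈ stdSkel (k + 4) (k + 2), ∀ s : I, G (t, s) ∈ A := by
    intro t ht s
    obtain ⟨i, j, z, rfl⟩ := exists_eq_stdFace_stdFace_of_mem_stdSkel ht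
    rw [hG, hR'', hR']
    refine hP.inA _ ?_ z s
    rintro _ ⟨w, rfl⟩
    rw [toContinuousMap_face_apply, toContinuousMap_face_apply, hτη]
    exact hA _ (stdFace_mem_stdSkel i (stdFace_mem_stdSkel j (by rw [stdSkel_eq_univ le_rfl]; exact mem_univ _)))
  have hvert : ∀ t ∈ stdSkel (k + 4) 0, ∀ s : I, G (t, s) = τ t := fun t ht s => by
    rw [hG, hP''.vert η t ht s, hτη]
  have hA' : ∀ t ∈ stdSkel (k + 4) (k + 2), τ' t ∈ A := fun t ht => hskelA t ht 1
  have hvz : ∀ i : Fin (k + 5), (stdSimplex.vertex (S := ℝ) i : StdSimplex (k + 4)) ∈ stdSkel (k + 4) 0 :=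
    fun i => vertex_mem_stdSkel_zero i
  have hvz₀ : (stdSimplex.vertex (S := ℝ) 0 : StdSimplex (k + 3)) ∈ stdSkel (k + 3) 0 :=
    vertex_mem_stdSkel_zero 0
  have hv' : ∀ i : Fin (k + 5), τ' (stdSimplex.vertex (S := ℝ) i) = a := fun i => by
    show G (_, 1) = a
    rw [hvert _ (hvz i), hv]
  have hone : ∀ t ∈ stdSkel (k + 4) 1, τ' t = a := by
    intro t ht
    show G (t, 1) = a
    rw [hG]
    refine hP''.one η (fun w hw => ?_) (fun w hw => ?_) t ht
    · rw [hτη]; exact hA _ (stdSkel_mono _ (by omega) hw)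
    · rw [hτη]; exact hv0 w hw
  refine ⟨τ', hA', hv', fun z hz => hone z (ConeProof.mem_stdSkel_one_of_edge hz), fun i => ?_⟩
  -- the facets move through maps of triples
  refine relSimplexClass_eq_of_homotopyWith _ _
    { toFun := fun p => G (stdFace i p.2, p.1)
      continuous_toFun := G.continuous.comp ((stdFace i).continuous.comp continuous_snd |>.prodMk continuous_fst)
      map_zero_left := fun t => by
        show G (stdFace i t, 0) = τ (stdFace i t)
        rw [hG, hP''.bot, hτη]
      map_one_left := fun t => rfl
      prop' := fun s => ⟨fun t ht => ?_, ?_⟩ }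
  · show G (stdFace i t, s) ∈ A
    exact hskelA _ (stdFace_mem_stdSkel i (by rwa [← stdBoundary_eq_stdSkel])) s
  · show G (stdFace i (stdSimplex.vertex 0), s) = a
    rw [hvert _ (stdFace_mem_stdSkel i hvz₀) s, stdFace_vertex, hv]

/-! ### The discharge -/

/-- **The homotopy addition theorem for relative classes** — discharge of the named fact
`relHomotopyAddition` (Spanier 1981, Ch. 7 §5 Prop. 3 `Bₙ`, `n ≥ 3`, in the pushed-forward form of (d)
p. 397): for `A` simply connected, `a ∈ A`, and `τ : Δᵏ⁺⁴ → X` with codimension-two skeleton in `A` and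
vertices at `a`, `∑ᵢ (-1)ⁱ [τ ∘ δᵢ] = 0` in `πₖ₊₃(X, A, a)`, `[·] = relSimplexClass`. Normalise the edges
(`exists_edge_normalisation`, where `π₁(A) = 0` enters, replacing Spanier's transport `h_{[v₀v₁]}`), then
apply `sum_neg_one_pow_smul_relSimplexClass_eq_zero` (the cone-class theorem transported by the device
rigidity `relSimplexClass = coneClass^{±1}`). [cite: Spanier1981, Ch. 7 §5 Prop. 3] -/
theorem relHomotopyAddition_holds : relHomotopyAddition.{u} := by
  intro X _ A _ a k τ hA hv
  obtain ⟨τ', hA', hv', he, hcls⟩ := exists_edge_normalisation (A := A) (a := a) τ hA hv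
  simp_rw [hcls]
  exact sum_neg_one_pow_smul_relSimplexClass_eq_zero τ' hA' hv' he

end Literature.AlgebraicTopology.SingularHomology

end
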